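import Summits.QuantumFields.BalabanUV.Beta.FP.PerfectColumnSharp
import Summits.QuantumFields.BalabanUV.Beta.FP.PerfectColumnTransportTail

/-!
# `BalabanUV.Beta.FP.PerfectColumnLatticeUnits` — road «FP» for binder row D1, row **KER-γ (β) «THE COLUMN EXPONENT»** of RULING R-FP-31
# (road-FP owner d1-p3-g8, journal 2026-08-21T03:17Z): the column `J := N⁴ • colOf (KPerf Lc (sfStep Lc) (smStep 3 Lc) m)`, `N = Lc^m`, carries
# EXACTLY the «lattice» letters — coset sums `δ_{κl}·N⁻¹`, sup `C·N⁻¹·e^{−(κ₀∕(4N))|p|₁}`, unit differences `C′·N⁻²·e^{−(κ₀∕(4N))|p|₁}`, exponentially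
# weighted `ℓ¹` mass `c·N³` — for EVERY `m ≥ 1` with `m`-FREE constants, and the END's sandwich reads `N⁸·dressedEntry w T = dressedEntry J T`

NOT IN PRINT; OUR BOOKKEEPING — a ×`N⁴` RE-SPELLING of two ACCEPTED tree theorems of this road BY NAME: this lineage's row IPROF-SHARP
`FP/PerfectColumnSharp.colOf_KPerf_sharp` (sup `C·N⁻⁵`, unit differences `C′·N⁻⁶`) and `FP/PerfectColumnTransportTail.transportLetters_perfCol`
(coset sums `δ_{κl}·N⁻⁵`, linear reproduction, `AbsMoment₂`, weighted `ℓ¹` mass `c∕N`), plus the [folklore] scaling algebra of `dressedSum`∕`dressedEntry`∕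
`ConstReproSum`∕`LinReproSum`∕`AbsMoment₂`.  The object is the LITERAL term `(((Lc ^ m : ℕ) : ℝ) ^ 4) • colOf (KPerf …)` (the owner's `J`; no `def`).
HONEST FRAMING (cell contract, verbatim): «discharging `BetaPertH` makes Bałaban's UV stability UNCONDITIONAL — a real constructive-QFT result; it is NOT
the continuum limit and NOT the Clay problem.»  HONEST DEPENDENCY (verbatim): «continuum YM on T⁴ ⇐ BetaPertH ∧ nine spine estimates (0/9 proved);
BetaPertH ⇐ (D1) ∧ (D4) ∧ CAP+tail; G-an2-4 gates asym, D1 and NE2/3/4.»  ABSOLUTE RULE (cell charter, verbatim): «No internally-minted statement may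
enter as a cited fact. Every hypothesis is either kernel-proved in this package or a verbatim quotation of a PUBLISHED theorem with page reference. The
manuscript(s) under audit are NOT citable for their own disputed steps — they are the thing under adjudication; programme-internal (2001/route/tribunal)
claims are never citable.»  Nothing is cited; 0 `def`, 0 `def … : Prop`, 0 sorry.  THIS MODULE DISCHARGES NOTHING of KER-γ (α) (the identity with the
perfect one-shot's full fine Hessian table `F m`, the `hessKer` regrouping, N0b-W — an2's W-4 lineage), NOTHING of RHOA-6e's ledger (it only supplies the
currency κ = 4 that ledger is written in), NOT hbook, NOT D1, NOT BetaPertH, NOT continuum, NOT Clay; NEVER «G-an2-4 closed», NOT (CONV-C) for G_k∕H_k.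
The owner's READING «`J` is the `U̇ = 𝓘v` column of GAMMA-0's chain rule at the perfect data» is (α)'s identity side and is NOT proved here.
The `‖b − N•v‖∞`-PROFILE shapes (J)∕(J′)∕(Δ) of the same columns are the owner's `FP/PerfectColumnEngineLetters.engineLetters_perfCol` (p246436, `C·N⁻⁵`,
`C·N⁻⁵·A(κ₀)`, `C′·N⁻⁶` before the `N⁴`); they are NOT restated here (cite, do not restate — owner l.26226).

CONTENT (`d = 3`, `2 ≤ Lc`; `w_m := colOf (KPerf Lc (sfStep Lc) (smStep 3 Lc) m)`, `N := ((Lc^m : ℕ) : ℝ)`, `J_m := N^4 • w_m`):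
* §1 [folklore] scaling algebra: `dressedSum_smul_smul` (`dressedSum (c•f) T (c•g) y = c²·dressedSum f T g y`, `tsum_mul_left`, no summability),
  **`dressedEntry_smul`** (`dressedEntry (c•w) T y a b = c²·dressedEntry w T y a b`), `constReproSum_smul`, `linReproSum_smul`, `absMoment₂_smul`,
  `summable_expWeight_smul`∕`tsum_expWeight_smul`.
* §2 THE SANDWICH: **`dressedEntry_J : dressedEntry J_m T y a b = N^8 · dressedEntry w_m T y a b`** — the END's (`FP/HorizontalRemainderPerfect`)
  `N⁸·dressedEntry w r (N•v)` IS `dressedEntry J r (N•v)`; `(N⁴)² = N⁸` is what pins κ = 4.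
* §3 THE LETTERS OF `J_m`, every `m ≥ 1`, constants `m`-free: **`constReproSum_J`** (`δ_{κl}·N⁻¹`), `linReproSum_J`, `absMoment₂_J`, **`sup_J`**
  (`|J_m κ l p| ≤ C·N⁻¹·e^{−(κ₀∕(4N))|p|₁}` and `|J_m κ l (p+e_ν) − J_m κ l p| ≤ C′·N⁻²·e^{−(κ₀∕(4N))|p|₁}`, ONE `κ₀`; projections `abs_J_le`, `abs_J_sub_le`), **`expL1_J`** (`Σ' e^{(δ∕N)|x|₁}|J_m κ l x| ≤ c·N³`),
  and the packaged **`latticeLetters_J`** = VERBATIM the letter list of R-FP-31 (β).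
Provenance: prover-b2b-balaban-gan24-p3-g21-0 (unit `b2b-balaban-gan24-p3`, gen 21 = road-FP K-side supplier lineage; joint first refusal R-FP-31), 2026-08-21.
-/

noncomputable section

open Literature.MathematicalPhysics.QuantumFieldTheory.Balaban1983to89
open Literature.MathematicalPhysics.QuantumFieldTheory.Balaban1983to89.Beta
open DecimatedMomentSummable (ConstReproSum LinReproSum AbsMoment₂ dressedSum)
open DecimatedMoment (cosetInd)
open B12Sec2to5 (l1)
open DressedMomentNormalisation (EKer dressedEntry)
open DyadicShell (Pt)
open Summit.QuantumFields.BalabanUV.Beta.GAN24.CombesThomas (sfStep smStep)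
open Summit.QuantumFields.BalabanUV.Beta.FP.PerfectObjectsT (KPerf)
open Summit.QuantumFields.BalabanUV.Beta.FP.TransportInfinityM (colOf)
open Summit.QuantumFields.BalabanUV.Beta.FP.PerfectColumnSharp (colOf_KPerf_sharp)
open Summit.QuantumFields.BalabanUV.Beta.FP.PerfectColumnTransportTail (transportLetters_perfCol constReproSum_colOf_KPerf)

namespace Summit.QuantumFields.BalabanUV.Beta.FP.PerfectColumnLatticeUnits

/-! ## §1 Scaling algebra ([folklore]) -/

section Scaling

variable {d : ℕ}

/-- [folklore] The two-sided dressed kernel is bilinear in its two patterns: `dressedSum (c•f) T (c•g) y = c²·dressedSum f T g y`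
(`tsum_mul_left`; no summability is needed). -/
theorem dressedSum_smul_smul (c : ℝ) (f T g : (Fin d → ℤ) → ℝ) (y : Fin d → ℤ) :
    dressedSum (c • f) T (c • g) y = c ^ 2 * dressedSum f T g y := by
  unfold dressedSum
  rw [← tsum_mul_left]
  refine tsum_congr fun p => ?_
  simp only [Pi.smul_apply, smul_eq_mul]
  ring

/-- [folklore] **The dressed matrix kernel scales quadratically in its column table**: `dressedEntry (c•w) T y a b = c²·dressedEntry w T y a b`. -/
theorem dressedEntry_smul (c : ℝ) (w T : EKer d) (y : Fin d → ℤ) (a b : Fin d) :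
    dressedEntry (c • w) T y a b = c ^ 2 * dressedEntry w T y a b := by
  unfold dressedEntry
  simp only [Pi.smul_apply]
  rw [Finset.mul_sum]
  refine Finset.sum_congr rfl fun i _ => ?_
  rw [Finset.mul_sum]
  refine Finset.sum_congr rfl fun e _ => ?_
  exact dressedSum_smul_smul c (w i a) (T i e) (w e b) y

/-- [folklore] Coset sums scale linearly: `ConstReproSum N w σ → ConstReproSum N (c•w) (c·σ)`. -/
theorem constReproSum_smul {N : ℕ} {w : (Fin d → ℤ) → ℝ} {σ : ℝ} (h : ConstReproSum N w σ) (c : ℝ) :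
    ConstReproSum N (c • w) (c * σ) := by
  intro a
  have h1 := (h a).mul_left c
  refine h1.congr_fun fun u => ?_
  simp only [Pi.smul_apply, smul_eq_mul, zsmul_eq_mul]
  ring

/-- [folklore] Linear reproduction sums scale linearly: `LinReproSum N w C → LinReproSum N (c•w) (c•C)`. -/
theorem linReproSum_smul {N : ℕ} {w : (Fin d → ℤ) → ℝ} {C : Fin d → ℝ} (h : LinReproSum N w C) (c : ℝ) :
    LinReproSum N (c • w) (c • C) := by
  intro a κ
  have h1 := (h a κ).mul_left c
  show HasSum (fun u => (cosetInd N (a - u) * u κ) • (c • w) u) (c * C κ)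
  refine h1.congr_fun fun u => ?_
  simp only [Pi.smul_apply, smul_eq_mul, zsmul_eq_mul]
  ring

/-- [folklore] Absolutely summable second moments scale: `AbsMoment₂ f → AbsMoment₂ (c•f)`. -/
theorem absMoment₂_smul {f : (Fin d → ℤ) → ℝ} (h : AbsMoment₂ f) (c : ℝ) : AbsMoment₂ (c • f) := by
  unfold AbsMoment₂ at h ⊢
  refine (h.mul_left |c|).congr fun y => ?_
  simp only [Pi.smul_apply, smul_eq_mul, abs_mul]
  ring

/-- [folklore] Exponentially weighted `ℓ¹` masses scale: summability. -/
theorem summable_expWeight_smul {φ : (Fin d → ℤ) → ℝ} {f : (Fin d → ℤ) → ℝ} (h : Summable fun x => φ x * |f x|) (c : ℝ) :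
    Summable fun x => φ x * |(c • f) x| := by
  refine (h.mul_left |c|).congr fun x => ?_
  simp only [Pi.smul_apply, smul_eq_mul, abs_mul]
  ring

/-- [folklore] Exponentially weighted `ℓ¹` masses scale: the sum. -/
theorem tsum_expWeight_smul (φ : (Fin d → ℤ) → ℝ) (f : (Fin d → ℤ) → ℝ) (c : ℝ) :
    ∑' x, φ x * |(c • f) x| = |c| * ∑' x, φ x * |f x| := by
  rw [← tsum_mul_left]
  refine tsum_congr fun x => ?_
  simp only [Pi.smul_apply, smul_eq_mul, abs_mul]
  ring

end Scaling

/-! ## §2 The sandwich identity for `J := N⁴ • colOf (KPerf … m)` -/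

section Column

variable {Lc : ℕ} [NeZero Lc]

/-- [our object] **THE END's SANDWICH IN THE COLUMN `J`**: with `w_m = colOf (KPerf Lc (sfStep Lc) (smStep 3 Lc) m)`, `N = Lc^m` and `J_m = N⁴ • w_m`,
`dressedEntry J_m T y a b = N⁸ · dressedEntry w_m T y a b` for every table `T`, point `y` and indices — the literal transported quantity
`N⁸·dressedEntry w (truncK K N) (N•v) μ ν` of `FP/HorizontalRemainderPerfect` is `dressedEntry J (truncK K N) (N•v) μ ν`.  (`(N⁴)² = N⁸`: the exponent
κ = 4 of R-FP-31 (β); a column scaled by `N⁵` would leave `N⁻²` outside the sandwich.) -/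
theorem dressedEntry_J (m : ℕ) (T : EKer 4) (y : Pt) (a b : Fin 4) :
    dressedEntry ((((Lc ^ m : ℕ) : ℝ) ^ 4) • colOf (KPerf (d := 3) Lc (sfStep Lc) (smStep 3 Lc) m)) T y a b
      = ((Lc ^ m : ℕ) : ℝ) ^ 8 * dressedEntry (colOf (KPerf (d := 3) Lc (sfStep Lc) (smStep 3 Lc) m)) T y a b := by
  rw [dressedEntry_smul]
  ring

/-! ## §3 The «lattice» letters of `J`, every `m ≥ 1`, with `m`-free constants -/

/-- [our object] **COSET SUMS `δ_{κl}·N⁻¹`**: `ConstReproSum N (J_m κ l) (if κ = l then N⁻¹ else 0)` for every `m ≥ 1`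
(`PerfectColumnTransportTail.constReproSum_colOf_KPerf`: `δ_{κl}·N⁻⁵`, times `N⁴`). -/
theorem constReproSum_J (hLc : 2 ≤ Lc) {m : ℕ} (hm : 1 ≤ m) (κ l : Fin 4) :
    ConstReproSum (Lc ^ m) (((((Lc ^ m : ℕ) : ℝ) ^ 4) • colOf (KPerf (d := 3) Lc (sfStep Lc) (smStep 3 Lc) m)) κ l)
      (if κ = l then (((Lc ^ m : ℕ) : ℝ))⁻¹ else 0) := by
  have hN : (0 : ℝ) < ((Lc ^ m : ℕ) : ℝ) := by
    have : 0 < Lc := lt_of_lt_of_le (by norm_num) hLc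
    exact_mod_cast pow_pos this m
  have h := constReproSum_smul (constReproSum_colOf_KPerf (Lc := Lc) hLc hm κ l) ((((Lc ^ m : ℕ) : ℝ) ^ 4))
  have e : (((Lc ^ m : ℕ) : ℝ) ^ 4) * (if κ = l then ((((Lc ^ m : ℕ) : ℝ) ^ (4 + 1))⁻¹) else 0)
      = (if κ = l then (((Lc ^ m : ℕ) : ℝ))⁻¹ else 0) := by
    split_ifs
    · field_simp
    · rw [mul_zero]
  rw [e] at h
  exact h

/-- [our object] **THE SUP AND UNIT-DIFFERENCE LETTERS OF `J`** (`PerfectColumnSharp.colOf_KPerf_sharp` times `N⁴`): ONE `κ₀ > 0` and `C, C′ ≥ 0` such that for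
every `m ≥ 1`, `κ l p ν`, with `N = Lc^m`: `|J_m κ l p| ≤ C·N⁻¹·e^{−(κ₀∕(4N))·|p|₁}` and `|J_m κ l (p + e_ν) − J_m κ l p| ≤ C′·N⁻²·e^{−(κ₀∕(4N))·|p|₁}`. -/
theorem sup_J (hLc : 2 ≤ Lc) :
    ∃ κ₀ C C' : ℝ, 0 < κ₀ ∧ 0 ≤ C ∧ 0 ≤ C' ∧
      (∀ m : ℕ, 1 ≤ m → ∀ (κ l : Fin 4) (p : Pt),
        |((((Lc ^ m : ℕ) : ℝ) ^ 4) • colOf (KPerf (d := 3) Lc (sfStep Lc) (smStep 3 Lc) m)) κ l p|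
          ≤ C * (((Lc ^ m : ℕ) : ℝ))⁻¹ * Real.exp (-(κ₀ / (4 * ((Lc ^ m : ℕ) : ℝ))) * l1 p)) ∧
      (∀ m : ℕ, 1 ≤ m → ∀ (κ l : Fin 4) (p : Pt) (ν : Fin 4),
        |((((Lc ^ m : ℕ) : ℝ) ^ 4) • colOf (KPerf (d := 3) Lc (sfStep Lc) (smStep 3 Lc) m)) κ l (p + Pi.single ν 1)
            - ((((Lc ^ m : ℕ) : ℝ) ^ 4) • colOf (KPerf (d := 3) Lc (sfStep Lc) (smStep 3 Lc) m)) κ l p|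
          ≤ C' * ((((Lc ^ m : ℕ) : ℝ)) ^ 2)⁻¹ * Real.exp (-(κ₀ / (4 * ((Lc ^ m : ℕ) : ℝ))) * l1 p)) := by
  obtain ⟨κ₀, C, C', hκ₀, hC, hC', hsup, hdiff⟩ := colOf_KPerf_sharp (Lc := Lc) hLc
  refine ⟨κ₀, C, C', hκ₀, hC, hC', fun m hm κ l p => ?_, fun m hm κ l p ν => ?_⟩
  · have hN : (0 : ℝ) < ((Lc ^ m : ℕ) : ℝ) := by
      have : 0 < Lc := lt_of_lt_of_le (by norm_num) hLc
      exact_mod_cast pow_pos this m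
    have h := hsup m hm κ l p
    have hcast : ((Lc : ℝ) ^ m) = ((Lc ^ m : ℕ) : ℝ) := by push_cast; ring
    rw [hcast] at h
    simp only [Pi.smul_apply, smul_eq_mul, abs_mul]
    rw [abs_of_nonneg (by positivity : (0 : ℝ) ≤ ((Lc ^ m : ℕ) : ℝ) ^ 4)]
    calc ((Lc ^ m : ℕ) : ℝ) ^ 4 * |colOf (KPerf (d := 3) Lc (sfStep Lc) (smStep 3 Lc) m) κ l p|
        ≤ ((Lc ^ m : ℕ) : ℝ) ^ 4 * (C * ((((Lc ^ m : ℕ) : ℝ)) ^ 5)⁻¹ * Real.exp (-(κ₀ / (4 * ((Lc ^ m : ℕ) : ℝ))) * l1 p)) :=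
          mul_le_mul_of_nonneg_left h (by positivity)
      _ = C * (((Lc ^ m : ℕ) : ℝ))⁻¹ * Real.exp (-(κ₀ / (4 * ((Lc ^ m : ℕ) : ℝ))) * l1 p) := by
          field_simp
  · have hN : (0 : ℝ) < ((Lc ^ m : ℕ) : ℝ) := by
      have : 0 < Lc := lt_of_lt_of_le (by norm_num) hLc
      exact_mod_cast pow_pos this m
    have h := hdiff m hm κ l p ν
    have hcast : ((Lc : ℝ) ^ m) = ((Lc ^ m : ℕ) : ℝ) := by push_cast; ring
    rw [hcast] at h
    simp only [Pi.smul_apply, smul_eq_mul]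
    rw [← mul_sub, abs_mul, abs_of_nonneg (by positivity : (0 : ℝ) ≤ ((Lc ^ m : ℕ) : ℝ) ^ 4)]
    calc ((Lc ^ m : ℕ) : ℝ) ^ 4 * |colOf (KPerf (d := 3) Lc (sfStep Lc) (smStep 3 Lc) m) κ l (p + Pi.single ν 1)
            - colOf (KPerf (d := 3) Lc (sfStep Lc) (smStep 3 Lc) m) κ l p|
        ≤ ((Lc ^ m : ℕ) : ℝ) ^ 4 * (C' * ((((Lc ^ m : ℕ) : ℝ)) ^ 6)⁻¹ * Real.exp (-(κ₀ / (4 * ((Lc ^ m : ℕ) : ℝ))) * l1 p)) :=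
          mul_le_mul_of_nonneg_left h (by positivity)
      _ = C' * ((((Lc ^ m : ℕ) : ℝ)) ^ 2)⁻¹ * Real.exp (-(κ₀ / (4 * ((Lc ^ m : ℕ) : ℝ))) * l1 p) := by
          field_simp

/-- [our object] The sup letter alone: `∃ κ₀ > 0, C ≥ 0, ∀ m ≥ 1, |J_m κ l p| ≤ C·N⁻¹·e^{−(κ₀∕(4N))·|p|₁}` (projection of `sup_J`). -/
theorem abs_J_le (hLc : 2 ≤ Lc) :
    ∃ κ₀ C : ℝ, 0 < κ₀ ∧ 0 ≤ C ∧ ∀ m : ℕ, 1 ≤ m → ∀ (κ l : Fin 4) (p : Pt),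
      |((((Lc ^ m : ℕ) : ℝ) ^ 4) • colOf (KPerf (d := 3) Lc (sfStep Lc) (smStep 3 Lc) m)) κ l p|
        ≤ C * (((Lc ^ m : ℕ) : ℝ))⁻¹ * Real.exp (-(κ₀ / (4 * ((Lc ^ m : ℕ) : ℝ))) * l1 p) := by
  obtain ⟨κ₀, C, _, hκ₀, hC, _, hsup, _⟩ := sup_J (Lc := Lc) hLc
  exact ⟨κ₀, C, hκ₀, hC, hsup⟩

/-- [our object] The unit-difference letter alone: `∃ κ₀ > 0, C′ ≥ 0, ∀ m ≥ 1, |J_m κ l (p + e_ν) − J_m κ l p| ≤ C′·N⁻²·e^{−(κ₀∕(4N))·|p|₁}`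
(projection of `sup_J`; the SAME `κ₀` as the sup letter is available from `sup_J`∕`latticeLetters_J`). -/
theorem abs_J_sub_le (hLc : 2 ≤ Lc) :
    ∃ κ₀ C' : ℝ, 0 < κ₀ ∧ 0 ≤ C' ∧ ∀ m : ℕ, 1 ≤ m → ∀ (κ l : Fin 4) (p : Pt) (ν : Fin 4),
      |((((Lc ^ m : ℕ) : ℝ) ^ 4) • colOf (KPerf (d := 3) Lc (sfStep Lc) (smStep 3 Lc) m)) κ l (p + Pi.single ν 1)
          - ((((Lc ^ m : ℕ) : ℝ) ^ 4) • colOf (KPerf (d := 3) Lc (sfStep Lc) (smStep 3 Lc) m)) κ l p|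
        ≤ C' * ((((Lc ^ m : ℕ) : ℝ)) ^ 2)⁻¹ * Real.exp (-(κ₀ / (4 * ((Lc ^ m : ℕ) : ℝ))) * l1 p) := by
  obtain ⟨κ₀, _, C', hκ₀, _, hC', _, hdiff⟩ := sup_J (Lc := Lc) hLc
  exact ⟨κ₀, C', hκ₀, hC', hdiff⟩

/-- [our object] **THE REPRODUCTION, MOMENT AND WEIGHTED-MASS LETTERS OF `J`** (`PerfectColumnTransportTail.transportLetters_perfCol` times `N⁴`): ONE
`(δ, c)` such that for every `m ≥ 1`, with `N = Lc^m`: coset sums `δ_{κl}·N⁻¹`, linear reproduction with SOME constants, `AbsMoment₂`, and the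
exponentially weighted `ℓ¹` mass `Σ' e^{(δ∕N)|x|₁}·|J_m κ l x| ≤ c·N³`. -/
theorem expL1_J (hLc : 2 ≤ Lc) : ∃ δ c : ℝ, 0 < δ ∧ 0 ≤ c ∧ ∀ m, 1 ≤ m →
    (∀ κ l, ConstReproSum (Lc ^ m) (((((Lc ^ m : ℕ) : ℝ) ^ 4) • colOf (KPerf (d := 3) Lc (sfStep Lc) (smStep 3 Lc) m)) κ l)
        (if κ = l then (((Lc ^ m : ℕ) : ℝ))⁻¹ else 0)) ∧
    (∃ Cw : Fin 4 → Fin 4 → Fin 4 → ℝ, ∀ κ l,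
        LinReproSum (Lc ^ m) (((((Lc ^ m : ℕ) : ℝ) ^ 4) • colOf (KPerf (d := 3) Lc (sfStep Lc) (smStep 3 Lc) m)) κ l) (Cw κ l)) ∧
    (∀ κ l, AbsMoment₂ (((((Lc ^ m : ℕ) : ℝ) ^ 4) • colOf (KPerf (d := 3) Lc (sfStep Lc) (smStep 3 Lc) m)) κ l)) ∧
    (∀ κ l, Summable fun x : Pt => Real.exp (δ / ((Lc ^ m : ℕ) : ℝ) * l1 x) *
        |((((Lc ^ m : ℕ) : ℝ) ^ 4) • colOf (KPerf (d := 3) Lc (sfStep Lc) (smStep 3 Lc) m)) κ l x|) ∧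
    (∀ κ l, ∑' x : Pt, Real.exp (δ / ((Lc ^ m : ℕ) : ℝ) * l1 x) *
        |((((Lc ^ m : ℕ) : ℝ) ^ 4) • colOf (KPerf (d := 3) Lc (sfStep Lc) (smStep 3 Lc) m)) κ l x| ≤
        c * ((Lc ^ m : ℕ) : ℝ) ^ 3) := by
  obtain ⟨δ, c, hδ, hc, h⟩ := transportLetters_perfCol (Lc := Lc) hLc
  refine ⟨δ, c, hδ, hc, fun m hm => ?_⟩
  obtain ⟨_, ⟨Cw, hCw⟩, hA, hE, hEb⟩ := h m hm
  have hN : (0 : ℝ) < ((Lc ^ m : ℕ) : ℝ) := by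
    have : 0 < Lc := lt_of_lt_of_le (by norm_num) hLc
    exact_mod_cast pow_pos this m
  -- the column slice of the scaled table is the scaled column slice
  have hslice : ∀ κ l, ((((Lc ^ m : ℕ) : ℝ) ^ 4) • colOf (KPerf (d := 3) Lc (sfStep Lc) (smStep 3 Lc) m)) κ l
      = (((Lc ^ m : ℕ) : ℝ) ^ 4) • colOf (KPerf (d := 3) Lc (sfStep Lc) (smStep 3 Lc) m) κ l := fun κ l => rfl
  refine ⟨fun κ l => constReproSum_J hLc hm κ l, ⟨fun κ l => (((Lc ^ m : ℕ) : ℝ) ^ 4) • Cw κ l, fun κ l => ?_⟩,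
    fun κ l => ?_, fun κ l => ?_, fun κ l => ?_⟩
  · rw [hslice]
    exact linReproSum_smul (hCw κ l) _
  · rw [hslice]
    exact absMoment₂_smul (hA κ l) _
  · rw [hslice]
    exact summable_expWeight_smul (hE κ l) _
  · rw [hslice, tsum_expWeight_smul, abs_of_nonneg (by positivity : (0 : ℝ) ≤ ((Lc ^ m : ℕ) : ℝ) ^ 4)]
    calc ((Lc ^ m : ℕ) : ℝ) ^ 4 * ∑' x : Pt, Real.exp (δ / ((Lc ^ m : ℕ) : ℝ) * l1 x) *
          |colOf (KPerf (d := 3) Lc (sfStep Lc) (smStep 3 Lc) m) κ l x|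
        ≤ ((Lc ^ m : ℕ) : ℝ) ^ 4 * (c / ((Lc ^ m : ℕ) : ℝ)) := mul_le_mul_of_nonneg_left (hEb κ l) (by positivity)
      _ = c * ((Lc ^ m : ℕ) : ℝ) ^ 3 := by field_simp

/-- [our object] **ROW KER-γ (β), PACKAGED — THE «LATTICE» LETTERS OF `J := N⁴ • colOf (KPerf … m)` VERBATIM** (`d = 3`, `2 ≤ Lc`): there are `κ₀, δ > 0`
and `C, C′, c ≥ 0` such that for EVERY `m ≥ 1`, with `N = Lc^m` and `J_m = N⁴ • colOf (KPerf Lc (sfStep Lc) (smStep 3 Lc) m)`, for all `κ l`: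
coset sums `δ_{κl}·N⁻¹` (`ConstReproSum`), sup `|J_m κ l p| ≤ C·N⁻¹·e^{−(κ₀∕(4N))|p|₁}`, unit differences `≤ C′·N⁻²·e^{−(κ₀∕(4N))|p|₁}`, exponentially
weighted mass `Σ' e^{(δ∕N)|x|₁}|J_m κ l x| ≤ c·N³` (summable), and `AbsMoment₂` — the currency κ = 4 in which RHOA-6e's N-power ledger is written
(R-FP-31: «a minimiser with `Q𝓘 = 1` for `Q = N⁻⁴Σ`, coset sum `N⁻¹`»).  Nothing about `F m` ∕ KER-γ (α) is claimed. -/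
theorem latticeLetters_J (hLc : 2 ≤ Lc) :
    ∃ κ₀ δ C C' c : ℝ, 0 < κ₀ ∧ 0 < δ ∧ 0 ≤ C ∧ 0 ≤ C' ∧ 0 ≤ c ∧ ∀ m : ℕ, 1 ≤ m → ∀ κ l : Fin 4,
      ConstReproSum (Lc ^ m) (((((Lc ^ m : ℕ) : ℝ) ^ 4) • colOf (KPerf (d := 3) Lc (sfStep Lc) (smStep 3 Lc) m)) κ l)
          (if κ = l then (((Lc ^ m : ℕ) : ℝ))⁻¹ else 0) ∧
      (∀ p : Pt, |((((Lc ^ m : ℕ) : ℝ) ^ 4) • colOf (KPerf (d := 3) Lc (sfStep Lc) (smStep 3 Lc) m)) κ l p|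
          ≤ C * (((Lc ^ m : ℕ) : ℝ))⁻¹ * Real.exp (-(κ₀ / (4 * ((Lc ^ m : ℕ) : ℝ))) * l1 p)) ∧
      (∀ (p : Pt) (ν : Fin 4),
        |((((Lc ^ m : ℕ) : ℝ) ^ 4) • colOf (KPerf (d := 3) Lc (sfStep Lc) (smStep 3 Lc) m)) κ l (p + Pi.single ν 1)
            - ((((Lc ^ m : ℕ) : ℝ) ^ 4) • colOf (KPerf (d := 3) Lc (sfStep Lc) (smStep 3 Lc) m)) κ l p|
          ≤ C' * ((((Lc ^ m : ℕ) : ℝ)) ^ 2)⁻¹ * Real.exp (-(κ₀ / (4 * ((Lc ^ m : ℕ) : ℝ))) * l1 p)) ∧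
      (Summable fun x : Pt => Real.exp (δ / ((Lc ^ m : ℕ) : ℝ) * l1 x) *
          |((((Lc ^ m : ℕ) : ℝ) ^ 4) • colOf (KPerf (d := 3) Lc (sfStep Lc) (smStep 3 Lc) m)) κ l x|) ∧
      (∑' x : Pt, Real.exp (δ / ((Lc ^ m : ℕ) : ℝ) * l1 x) *
          |((((Lc ^ m : ℕ) : ℝ) ^ 4) • colOf (KPerf (d := 3) Lc (sfStep Lc) (smStep 3 Lc) m)) κ l x| ≤ c * ((Lc ^ m : ℕ) : ℝ) ^ 3) ∧
      AbsMoment₂ (((((Lc ^ m : ℕ) : ℝ) ^ 4) • colOf (KPerf (d := 3) Lc (sfStep Lc) (smStep 3 Lc) m)) κ l) := by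
  obtain ⟨κ₀, C, C', hκ₀, hC, hC', hsup, hdiff⟩ := sup_J (Lc := Lc) hLc
  obtain ⟨δ, c, hδ, hc, h⟩ := expL1_J (Lc := Lc) hLc
  refine ⟨κ₀, δ, C, C', c, hκ₀, hδ, hC, hC', hc, fun m hm κ l => ?_⟩
  obtain ⟨h0, _, hA, hE, hEb⟩ := h m hm
  exact ⟨h0 κ l, fun p => hsup m hm κ l p, fun p ν => hdiff m hm κ l p ν, hE κ l, hEb κ l, hA κ l⟩

end Column

end Summit.QuantumFields.BalabanUV.Beta.FP.PerfectColumnLatticeUnits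

end
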